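import Summits.QuantumFields.BalabanUV.T4Continuum.Support.NE7CurvedLiftBookkeepingApproxHomTwoTerm
import Summits.QuantumFields.BalabanUV.T4Continuum.Support.NE7ExpansionRemainderCurvedStrong
import Summits.QuantumFields.BalabanUV.T4Continuum.Support.NE7TanCriticalGauge
import Summits.QuantumFields.BalabanUV.T4Continuum.Support.NE7ConvOneStepWeightedUnique
import Summits.QuantumFields.BalabanUV.T4Continuum.Spine.NE3.CurvedLandauRep
import HarnessLib

/-!
# NE7ApeCurvedRepDockingStrongH — TWIN (t4-ne7-p1 gen 80) of `NE7ApeCurvedRepDockingStrong` with the slice-solver letter in the HOMOGENEOUS TWO-TERM shape (L2)ʰ `‖curlAt W X‖ ≤ K_G·g + K_X·R` (`R` a sup bound of `X`)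
# and the normal part's sup bound `a_N` displayed; conclusion radius gains `+ K_X·(α₀ + a_N)` next to `c_N`.  WHY: the one-term letter of the original (with `hS ⊇ tangent` downstream)
# is UNSATISFIABLE at curved data (F128 `NE7SliceLetterGaugeObstruction`, F130 `NE7SliceLetterConstantFluxWitness`); (L2)ʰ is consistent at every background (trivially with
# `K_G = 0`, `K_X = 4`) and its content is the size of `(K_G, K_X)`.  Memo `t4/b2b-balaban-t4-ne7-p1-g80/SLICE-LETTER-OBSTRUCTION.md` §3.  Everything else VERBATIM from the original
# (whose header follows); HONEST FRAMING as there: composition over displayed letters, nothing of Bałaban's asserted, (APE) on curved data NOT proved, NOT NE7, spine 0∕9, NOT Clay.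
-/

/-!
# NE7ApeCurvedRepDockingStrong — (APE) WITH A DATUM, THE EXPANSION LETTER IN CLOSING CURRENCY: F60's docking with (hEXP) DISCHARGED by the STRONG curved remainder
# F65 — the displayed analytic letters are now exactly (L1) the normal lift (approximate NORTH), (L2) the slice solver, (L3) the background tension, (L4) the
# tangent transport, plus the GRADIENT MEMBER `α₁` of the Landau representative ([B8] (1.36)₂ TYPE — E′ supplies only the sup member)

Cell `pub-balaban`, rung (B)+1 sub-cell t4, lineage `b2b-balaban-t4-ne7-p1` (CRUX PROVER NE7 #1 = OWNER of row NE7), generation 75.  File F66 = F59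
`NE7CurvedLiftBookkeepingApprox` ∘ row NE3's E′ `Spine/NE3/CurvedLandauRep.exists_landauRep_W` ∘ F65 `NE7ExpansionRemainderCurvedStrong.abs_dAction_vary_sub_dAction_sub_hess_le_W_strong`
∘ F39 `NE7TanCriticalGauge.tanCritical_gaugeAct` ∘ `NE7ConvOneStepWeightedUnique.smallField_of_gaugeAct_eq`.

WHAT ([folklore]; 0 def, 0 sorry).  **`smallField_of_tanCritical_curvedLetters_W_strongExp`** — F60's statement with the weak `ρ_W` replaced by F65's strong
`ρ_W = #Plane·(2c_loc + 64α₀α₁ + 1024xα₀²)` (every term `O(M⁻³)` in the currencies `α₀ = α̂∕M`, `α₁ = α̂₁∕M²`, `x = b∕M²`, `NE7ExpansionRemainderCurvedCurrency.rhoW_strong_currency`) and ONE added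
displayed letter: the forward covariant gradient member `‖Ad_{W(y+e_κ,τ)}Z(y+e_τ,κ) − Z(y,κ)‖ ≤ α₁` of every Landau representative with the sup member.
HONEST FRAMING (page 1): composition; (L1) (L2) (L4) at a curved `W` and the gradient member are NOT proved; nothing of Bałaban's asserted ([Balaban1985Variational]
Sect. F TYPE); (APE) on curved data NOT proved; NOT ONE-STEP, NOT NE7; spine 0∕9; finite T⁴ rung (B)+1 — NOT infinite volume, NOT mass gap, NOT `BetaPertH`, NOT Clay.
Continuum YM on T⁴ ⇐ BetaPertH ∧ nine spine estimates (0/9 proved); BetaPertH ⇐ (D1) ∧ (D4) ∧ CAP+tail; G-an2-4 gates asym, D1 and NE2/3/4.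
-/

set_option autoImplicit false

open scoped BigOperators Matrix Matrix.Norms.L2Operator
open NormedSpace Finset Set

namespace Summit.QuantumFields.BalabanUV.T4Continuum.NE7ApeCurvedRepDockingStrongH

open Literature.MathematicalPhysics.QuantumFieldTheory.Balaban1983to89
open B7Prop1Explicit B7Prop2Explicit MatrixLog UnitaryModel
open T4AveragingDeficitWall (Ad IsUnitaryCfg IsSkewDir SmallField vary curlAt dirL1)
open T4AveragingDeficitWallBoundary (IsPeriodicCfg periodBox)
open AveragingDeficitPeriodicCounting (IsPeriodicDir)
open AveragingDeficitMultiLevelPrep (LevelSmall)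
open MinimalActionLevels (perWin)
open NE3HessForm (hess dAction)
open NE3TangentCovariantTower (dirIter)
open NE3EnergyShapes (IsUnitarySite IsPeriodicSite)
open NE3CovariantWeitzenbock (covDiv)
open NE3RightInverseSupLetters (frameC)
open NE3.PairLandauB8 (IsLandauB8)
open NE3.CurvedLandauRep (exists_landauRep_W)
open NE7TanCriticalGauge (tanCritical_gaugeAct)
open NE7ConvOneStepWeightedUnique (smallField_of_gaugeAct_eq)
open NE7CurvedLiftBookkeepingApproxHomTwoTerm (smallField_vary_of_curvedLetters_approxHomTwoTerm)
open NE7ExpansionRemainderCurvedStrong (abs_dAction_vary_sub_dAction_sub_hess_le_W_strong)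

noncomputable section

variable {d : ℕ} {n : Type*} [Fintype n] [DecidableEq n]

/-- **(APE) WITH A DATUM, EXPANSION LETTER IN CLOSING CURRENCY** (statement in the module docstring). [folklore] -/
theorem smallField_of_tanCritical_curvedLetters_W_strongExp [Nonempty n] (hd : 1 ≤ d) {L N : ℕ} [NeZero N] (hL : 2 ≤ L) (j : ℕ)
    -- the background
    {W : Site d → Fin d → (Matrix n n ℂ)ˣ} {x x₁ : ℝ} (hWu : IsUnitaryCfg W) (hWP : IsPeriodicCfg W ((N * L ^ (j + 1) : ℕ) : ℤ))
    (hx : 0 ≤ x) (hs : LevelSmall d L j x) (hWx : SmallField W x) (hx10 : 0 ≤ x₁)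
    (hgrad : ∀ (p : Site d) (μ κ : Fin d), κ ≠ μ →
      ‖Ad (W p μ) ((hol W (p + e μ) (plaqWord κ μ) : (Matrix n n ℂ)ˣ) : Matrix n n ℂ) - ((hol W p (plaqWord κ μ) : (Matrix n n ℂ)ˣ) : Matrix n n ℂ)‖ ≤ x₁)
    (hbx : 23040 * (d : ℝ) ^ 4 * (frameC d L + d) ^ 2 * ((L : ℝ) ^ (j + 1)) ^ 2 * x ≤ 1)
    (hcx : 11520 * (d : ℝ) ^ 4 * (frameC d L + d) ^ 3 * ((L : ℝ) ^ (j + 1)) ^ 3 * x₁ ≤ 1)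
    (hbx' : 256 * (d : ℝ) ^ 2 * ((L : ℝ) ^ (j + 1)) ^ 2 * x ≤ 1) (hcx' : 16 * (d : ℝ) * ((L : ℝ) ^ (j + 1)) ^ 3 * x₁ ≤ 1)
    -- the field: of the class, tangent-critical, (−1)/(−2)-close to `W`
    {U : Site d → Fin d → (Matrix n n ℂ)ˣ} (hUu : IsUnitaryCfg U) (hUP : IsPeriodicCfg U ((N * L ^ (j + 1) : ℕ) : ℤ))
    {xU : ℝ} (hxU : 0 ≤ xU) (hsU : LevelSmall d L j xU) (hUxU : SmallField U xU)
    (hcritU : ∀ Y : Site d → Fin d → Matrix n n ℂ, IsSkewDir Y → IsPeriodicDir Y ((N * L ^ (j + 1) : ℕ) : ℤ) →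
      dirIter L (j + 1) U Y = 0 → dAction U Y (perWin d (N * L ^ (j + 1))) = 0)
    {r₀ b₀ : ℝ} (hr₀ : ∀ (y : Site d) (μ : Fin d), ‖(((W y μ)⁻¹ * U y μ : (Matrix n n ℂ)ˣ) : (Matrix n n ℂ)) - 1‖ ≤ r₀)
    (hb₀ : ∀ x : Site d, ‖covDiv W (fun y μ => mlog (((W y μ)⁻¹ * U y μ : (Matrix n n ℂ)ˣ) : (Matrix n n ℂ))) x‖ ≤ b₀)
    (hreg₁ : (36 * (d : ℝ) * (frameC d L + d) ^ 2) * ((L : ℝ) ^ (j + 1)) ^ 2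
      * ((1 + 2 * (Fintype.card n : ℝ) * (64 * (d : ℝ) ^ 2 * N) ^ d + 27 * (Fintype.card n : ℝ) ^ 3 * (512 : ℝ) ^ d * (N : ℝ) ^ d) * b₀) ≤ 1 / 10)
    (hreg₂ : (36 * (d : ℝ) * (frameC d L + d)) * (L : ℝ) ^ (j + 1)
      * ((1 + 2 * (Fintype.card n : ℝ) * (64 * (d : ℝ) ^ 2 * N) ^ d + 27 * (Fintype.card n : ℝ) ^ 3 * (512 : ℝ) ^ d * (N : ℝ) ^ d) * b₀) ≤ 1 / 25)
    (hreg₃ : r₀ + 5 / 2 * ((36 * (d : ℝ) * (frameC d L + d)) * (L : ℝ) ^ (j + 1)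
      * ((1 + 2 * (Fintype.card n : ℝ) * (64 * (d : ℝ) ^ 2 * N) ^ d + 27 * (Fintype.card n : ℝ) ^ 3 * (512 : ℝ) ^ d * (N : ℝ) ^ d) * b₀)) ≤ 1 / 20)
    (hline : (1 + 2 * (Fintype.card n : ℝ) * (64 * (d : ℝ) ^ 2 * N) ^ d + 27 * (Fintype.card n : ℝ) ^ 3 * (512 : ℝ) ^ d * (N : ℝ) ^ d)
      * (4 * ((36 * (d : ℝ) * (frameC d L + d) ^ 2) * ((L : ℝ) ^ (j + 1)) ^ 2)
          * (b₀ + 4 * ((1 + 2 * (Fintype.card n : ℝ) * (64 * (d : ℝ) ^ 2 * N) ^ d + 27 * (Fintype.card n : ℝ) ^ 3 * (512 : ℝ) ^ d * (N : ℝ) ^ d) * b₀))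
        + 25 * d * (r₀ + 5 / 2 * ((36 * (d : ℝ) * (frameC d L + d)) * (L : ℝ) ^ (j + 1)
            * ((1 + 2 * (Fintype.card n : ℝ) * (64 * (d : ℝ) ^ 2 * N) ^ d + 27 * (Fintype.card n : ℝ) ^ 3 * (512 : ℝ) ^ d * (N : ℝ) ^ d) * b₀)))
            * ((36 * (d : ℝ) * (frameC d L + d)) * (L : ℝ) ^ (j + 1))
        + 14 * d * ((36 * (d : ℝ) * (frameC d L + d)) * (L : ℝ) ^ (j + 1)) ^ 2
            * ((1 + 2 * (Fintype.card n : ℝ) * (64 * (d : ℝ) ^ 2 * N) ^ d + 27 * (Fintype.card n : ℝ) ^ 3 * (512 : ℝ) ^ d * (N : ℝ) ^ d) * b₀)) ≤ 1 / 2)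
    -- the sup radius of the representative
    {α₀ : ℝ} (hα0 : 0 ≤ α₀) (hα₀ : 2 * (r₀ + 5 / 2 * ((36 * (d : ℝ) * (frameC d L + d)) * (L : ℝ) ^ (j + 1)
        * ((1 + 2 * (Fintype.card n : ℝ) * (64 * (d : ℝ) ^ 2 * N) ^ d + 27 * (Fintype.card n : ℝ) ^ 3 * (512 : ℝ) ^ d * (N : ℝ) ^ d) * b₀))) ≤ α₀)
    -- the four remaining analytic letters at `W`
    (S : Set (Site d → Fin d → Matrix n n ℂ)) {cN aN KG KX κ τ ν : ℝ} (hκ : 0 ≤ κ) (hτ : 0 ≤ τ) (hν : 0 ≤ ν)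
    (hNlift : ∀ Z : Site d → Fin d → Matrix n n ℂ, IsSkewDir Z → IsPeriodicDir Z ((N * L ^ (j + 1) : ℕ) : ℤ) →
      IsLandauB8 (d := d) L N (j + 1) W Z → (∀ y μ, ‖Z y μ‖ ≤ α₀) →
      ∃ AN : Site d → Fin d → Matrix n n ℂ, IsPeriodicDir AN ((N * L ^ (j + 1) : ℕ) : ℤ) ∧ (∀ y μ, ‖AN y μ‖ ≤ aN) ∧
        dirIter L (j + 1) W AN = dirIter L (j + 1) W Z ∧
        (∀ z μ' ν', μ' ≠ ν' → ‖curlAt W AN z μ' ν'‖ ≤ cN) ∧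
        (∀ Y : Site d → Fin d → Matrix n n ℂ, IsSkewDir Y → IsPeriodicDir Y ((N * L ^ (j + 1) : ℕ) : ℤ) → dirIter L (j + 1) W Y = 0 →
          |hess W AN Y (perWin d (N * L ^ (j + 1)))| ≤ ν * dirL1 Y (periodBox (d := d) (N * L ^ (j + 1)))) ∧
        (fun y μ => Z y μ - AN y μ) ∈ S)
    {α₁ : ℝ} (hα1 : 0 ≤ α₁)
    (hGrad : ∀ Z : Site d → Fin d → Matrix n n ℂ, IsSkewDir Z → IsPeriodicDir Z ((N * L ^ (j + 1) : ℕ) : ℤ) →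
      IsLandauB8 (d := d) L N (j + 1) W Z → (∀ y μ, ‖Z y μ‖ ≤ α₀) →
      ∀ (y : Site d) (κ τ : Fin d), ‖Ad (W (y + e κ) τ) (Z (y + e τ) κ) - Z y κ‖ ≤ α₁)
    (hG : ∀ X ∈ S, IsPeriodicDir X ((N * L ^ (j + 1) : ℕ) : ℤ) → dirIter L (j + 1) W X = 0 → ∀ R : ℝ, (∀ y κ', ‖X y κ'‖ ≤ R) → ∀ g : ℝ, 0 ≤ g →
      (∀ Y : Site d → Fin d → Matrix n n ℂ, IsSkewDir Y → IsPeriodicDir Y ((N * L ^ (j + 1) : ℕ) : ℤ) → dirIter L (j + 1) W Y = 0 →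
        |hess W X Y (perWin d (N * L ^ (j + 1)))| ≤ g * dirL1 Y (periodBox (d := d) (N * L ^ (j + 1)))) →
      ∀ z μ' ν', μ' ≠ ν' → ‖curlAt W X z μ' ν'‖ ≤ KG * g + KX * R)
    (hWten : ∀ Y : Site d → Fin d → Matrix n n ℂ, IsSkewDir Y → IsPeriodicDir Y ((N * L ^ (j + 1) : ℕ) : ℤ) → dirIter L (j + 1) W Y = 0 →
      |dAction W Y (perWin d (N * L ^ (j + 1)))| ≤ κ * dirL1 Y (periodBox (d := d) (N * L ^ (j + 1))))
    (hTT : ∀ Z : Site d → Fin d → Matrix n n ℂ, IsSkewDir Z → IsPeriodicDir Z ((N * L ^ (j + 1) : ℕ) : ℤ) →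
      IsLandauB8 (d := d) L N (j + 1) W Z → (∀ y μ, ‖Z y μ‖ ≤ α₀) →
      ∀ Y : Site d → Fin d → Matrix n n ℂ, IsSkewDir Y → IsPeriodicDir Y ((N * L ^ (j + 1) : ℕ) : ℤ) → dirIter L (j + 1) W Y = 0 →
      ∃ Y' : Site d → Fin d → Matrix n n ℂ, IsSkewDir Y' ∧ IsPeriodicDir Y' ((N * L ^ (j + 1) : ℕ) : ℤ) ∧ dirIter L (j + 1) (vary W Z 1) Y' = 0 ∧
        |dAction (vary W Z 1) (fun y μ => Y' y μ - Y y μ) (perWin d (N * L ^ (j + 1)))| ≤ τ * dirL1 Y (periodBox (d := d) (N * L ^ (j + 1)))) :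
    SmallField U (x + (KG * (τ + (Fintype.card (T4AveragingDeficitWall.Plane d) : ℝ)
          * (2 * (240 * (Real.exp α₀ - 1) * α₀ * (2 * α₁ + 24 * α₀ * (Real.exp α₀ - 1) + x) + 8 * α₀ * (2 * α₁ + 24 * α₀ * (Real.exp α₀ - 1))
              + 6 * (Real.exp α₀ - 1) * (2 * α₁ + 24 * (Real.exp α₀ - 1) * α₀)
              + (2 * α₁ + 24 * (Real.exp α₀ - 1) * α₀) * (2 * α₁ + 24 * α₀ * (Real.exp α₀ - 1))
              + 960 * (Real.exp α₀ - 1) * α₀ ^ 2 + 32 * x * α₀ ^ 2)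
            + (64 * α₀ * α₁ + 1024 * x * α₀ ^ 2)) + κ + ν) + KX * (α₀ + aN) + cN + 28 * α₀ ^ 2)) := by
  have hP : 1 ≤ N * L ^ (j + 1) := Nat.mul_pos (Nat.pos_of_ne_zero (NeZero.ne N)) (Nat.pow_pos (by omega))
  have hPP : IsPeriodicCfg W (((N * L ^ (j + 1) : ℕ)) : ℤ) := hWP
  have hρ0 : 0 ≤ (Fintype.card (T4AveragingDeficitWall.Plane d) : ℝ)
          * (2 * (240 * (Real.exp α₀ - 1) * α₀ * (2 * α₁ + 24 * α₀ * (Real.exp α₀ - 1) + x) + 8 * α₀ * (2 * α₁ + 24 * α₀ * (Real.exp α₀ - 1))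
              + 6 * (Real.exp α₀ - 1) * (2 * α₁ + 24 * (Real.exp α₀ - 1) * α₀)
              + (2 * α₁ + 24 * (Real.exp α₀ - 1) * α₀) * (2 * α₁ + 24 * α₀ * (Real.exp α₀ - 1))
              + 960 * (Real.exp α₀ - 1) * α₀ ^ 2 + 32 * x * α₀ ^ 2)
            + (64 * α₀ * α₁ + 1024 * x * α₀ ^ 2)) := by
    have hδ0 : 0 ≤ Real.exp α₀ - 1 := by have := Real.add_one_le_exp α₀; linarith
    positivity
  have hL1 : 1 ≤ L := by omega
  -- brick E′: the Landau representative relative to `W`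
  obtain ⟨u, Z, huU, huP, hZs, hZP, hrep, hLan, -, hZsup, -, -⟩ :=
    exists_landauRep_W hd hL j hWu hWP hx hs hWx hx10 hgrad hbx hcx hbx' hcx' hUu hUP hr₀ hb₀ hreg₁ hreg₂ hreg₃ hline
  have hZα : ∀ y μ, ‖Z y μ‖ ≤ α₀ := fun y μ => (hZsup y μ).trans hα₀
  -- tangent-criticality is gauge covariant
  have hcrit' : ∀ Y' : Site d → Fin d → Matrix n n ℂ, IsSkewDir Y' → IsPeriodicDir Y' ((N * L ^ (j + 1) : ℕ) : ℤ) →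
      dirIter L (j + 1) (vary W Z 1) Y' = 0 → dAction (vary W Z 1) Y' (perWin d (N * L ^ (j + 1))) = 0 := by
    rw [← hrep]
    exact tanCritical_gaugeAct hL1 j hUu hxU hsU hUxU huU huP hcritU
  -- the letters at this representative; hEXP by F56
  obtain ⟨AN, hNP, hNsup, hNexact, hN7, hNorth, hTS⟩ := hNlift Z hZs hZP hLan hZα
  have hZ1 := hGrad Z hZs hZP hLan hZα
  have hEXP : ∀ Y : Site d → Fin d → Matrix n n ℂ, IsSkewDir Y → IsPeriodicDir Y ((N * L ^ (j + 1) : ℕ) : ℤ) →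
      |dAction (vary W Z 1) Y (perWin d (N * L ^ (j + 1))) - dAction W Y (perWin d (N * L ^ (j + 1))) - hess W Z Y (perWin d (N * L ^ (j + 1)))|
        ≤ (Fintype.card (T4AveragingDeficitWall.Plane d) : ℝ)
          * (2 * (240 * (Real.exp α₀ - 1) * α₀ * (2 * α₁ + 24 * α₀ * (Real.exp α₀ - 1) + x) + 8 * α₀ * (2 * α₁ + 24 * α₀ * (Real.exp α₀ - 1))
              + 6 * (Real.exp α₀ - 1) * (2 * α₁ + 24 * (Real.exp α₀ - 1) * α₀)
              + (2 * α₁ + 24 * (Real.exp α₀ - 1) * α₀) * (2 * α₁ + 24 * α₀ * (Real.exp α₀ - 1))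
              + 960 * (Real.exp α₀ - 1) * α₀ ^ 2 + 32 * x * α₀ ^ 2)
            + (64 * α₀ * α₁ + 1024 * x * α₀ ^ 2))
          * dirL1 Y (periodBox (d := d) (N * L ^ (j + 1))) :=
    fun Y _ hYP => abs_dAction_vary_sub_dAction_sub_hess_le_W_strong hP hWu hPP hx hWx hZs hZP hα0 hα1 hZα hZ1 hYP
  -- F59 on the representative
  have hSF := smallField_vary_of_curvedLetters_approxHomTwoTerm hL1 j hWu hx hs hWx hZs hZP hZα hNP hNsup hNexact hN7 hν hNorth S hTS hG hρ0 hEXP hκ hWten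
    hcrit' hτ (hTT Z hZs hZP hLan hZα)
  -- the radius is gauge invariant
  exact smallField_of_gaugeAct_eq huU hrep hSF

end

end Summit.QuantumFields.BalabanUV.T4Continuum.NE7ApeCurvedRepDockingStrongH

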